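import Summits.BirchSwinnertonDyer.BirchSwinnertonDyer.Theorems.SignedLowerHalvesKobayashiMainConjectureSmallImageMuTransferCM
import Summits.BirchSwinnertonDyer.BirchSwinnertonDyer.Theorems.SignedLowerHalvesKobayashiMainConjectureSmallImageCMTransferRecordsA
import Summits.BirchSwinnertonDyer.BirchSwinnertonDyer.Theorems.Rank1ResidualX11RankOneReduction
import Summits.BirchSwinnertonDyer.Rank1Residual.X12.ThreeIrrRecords
import Summits.BirchSwinnertonDyer.Rank1Residual.SecondDescent.EmptyRecordsThree3Nn01
import Summits.BirchSwinnertonDyer.Rank1Residual.Supersingular.NonsplitCartanThreeDescentRecordsX7Three01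
import Summits.BirchSwinnertonDyer.Rank1Residual.Supersingular.NonsplitCartanThreeDescentRecordsX7Three05
import Literature.NumberTheory.EllipticCurves.Fisher2012.HesseFamilyThreeCongruenceProofs
import Literature.NumberTheory.EllipticCurves.Fisher2012.HesseFamilyThreeReverseProofs
import Literature.NumberTheory.EllipticCurves.PointCountEulerCriterion
import HarnessLib

/-!
# Route `SignedLowerHalves`, crux `KobayashiMainConjectureSmallImage` (item stmt-BirchSwinnertonDyer-19002) —
# «CM-25» records part B (3 pairs @ 3: 20938a1, 92450t1, 368098c1): Kobayashi's ± main conjecture for rank-0 non-surjective `a_3 = 0` pairs that DO have a CM elliptic-curve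
# partner after all (finding «CM-25» of the seat's MEMO-8), by the cell's L4-PUB road — PUBLISHED named facts + displayed certificates,
# NO preprint binder (cell `bsd-ssimc`, seat `bsd-ssimc-k3-c4` gen 8; `--supports stmt-BirchSwinnertonDyer-19002 --as helper`)

HONEST FRAMING: Kobayashi's signed main conjecture at a non-surjective (normaliser-of-non-split-Cartan) image is OPEN as a class
statement; item 4 stays OPEN; nothing here is booked; BSD is not proved by any of this. These are PER-PAIR theorems.

THE FINDING. The seat's gen-0 census (`cm_congruence_probe.tsv`, evidence #4 on the item; MEMO-1 / MEMO-3) booked 57 of item 4's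
136 window pairs as «no CM elliptic-curve partner». At `p = 3` that probe searched partners only in the `j = 1728` family (its own
note: «p=3: 57 via y^2=x^3+Dx»), i.e. CM by `ℚ(i)`. But the quadratic field `K` cut out by the normaliser character of `ρ̄_{E,3}`
(recorded in the same table) is, for 31 of those pairs, one of `ℚ(√−7)`, `ℚ(√−19)`, `ℚ(√−43)`, `ℚ(√−67)`, `ℚ(√−163)` — class
number one, `3` inert — and for 22 of them the CM curve `A_D` of that field (or a quadratic twist of it) IS `3`-congruent to `E`:
trace test over 40 good primes (evidence, `HOME/bsd-ssimc-k3-c4/g8/cmcheck/`), then — the only thing used here — an EXACT Fisher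
Hesse-pencil identity found by g5's `cert/hesse3_find.py` and re-checked in the kernel by `norm_num`
(`threeCongruent_of_hesseCertificate_unconditional` / `…dualHesseCertificate_unconditional`). (Three more pairs at `p = 5` —
207616g1, 207616h1, 301824bp1, partners of CM field `ℚ(√−2)` — and the rank-1 pair 380894f1 @ 3 are the OPEN desk cells of the
finding and go through the small-image congruence road «L4-λ» in a separate file.)

MECHANISM (verbatim the cell's L4-PUB μ-road, g4, `kobayashiMainConjecture_of_cmPartner_of_bsdp_of_analyticRank_eq_zero`, file
`…SmallImageMuTransferCM.lean` p447806, REPORT-k3c4-5 PASS): Pollack–Rubin 2004 (`hPR`, the ± main conjecture for the CM partner `A` at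
the inert prime `3`) + the partner's displayed μ-binder `hμ'` (`μ(L_3^±(A)) = 0`; certificate VALUES quoted per record: the two-engine
Mazur–Tate layer readings of kit j268836 — engine A = PARI `ellpadiclambdamu` via k3-c4 g2's `engineA.py` a8b8e893, engine B = the b2b
msengine (`MSENGINE_SHA256SUMS`), engine T = iw-2's `engT.py` d8b96ce8, all byte-identical re-uses) ⟹ `μ(X^±(A)) = 0` ⟹ (B. D. Kim 2009 Cor.
2.13, `h09`, along the kernel congruence) `μ(X^±(E)) = 0` ⟹ Kobayashi's RATIONAL Kato divisibility (`h41`) is integral (Gauss) ⟹ with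
`r_an(E) = 0` and the pair's own `BSD(E,3)` (the b2b lane's flag-free exact-descent theorem `bsdp3_nn<label>` — for 20938a1 the
second-descent theorem `bsdp3_b1e_20938a1` — binders passed through and DISPLAYED) the constant-term squeeze (`hKim`, `h12`, `h5`, `h3`,
`hGZK`, `hmod`, `hmod'`, `hPollack`) gives the EQUALITY for BOTH signs. Every CM partner here has analytic rank `1` (Gross's CM curves and
their twists: `L(A,1) = 0`), so Kurihara's unit-`L`-value variant does not apply and the μ-binder is the displayed input, exactly as
in the cell's PubMuRecords01–12 / 18.

Non-kernel inputs per pair, all displayed: `hμ'` (values quoted), Cremona's `r_an = 0` and `#Ш_an` of `E`, the b2b descent line of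
`E`. NO Corpuz–Lei / BSTW / Fouquet–Wan binder, NO `Surj`, NO Mazur–Tate congruence `hMT`.

PARTITION (cell bsd-ssimc): X7 (A7) × the CM-25 pairs @ 3 listed in §2 (all `proved` cells on referee A's live state — records =
item-4 coverage, 0 census moves); closes NONE.

References: [BDKim2009] Cor. 2.13; [Kobayashi2003] Thm. 1.2, Thm. 4.1, Conjecture (p. 2); [PollackRubin2004] Thm. (p. 448);
[BDKim2013] Cor. 3.15; [Fisher2012Hessian] Thm. 13.2 and §13; [Cremona2006]; [Miller2011LMS] Def. 1.1; [SilvermanAEC2009] V §2,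
App. C §11. Memo: `HOME/k3c4-MEMO-8.md` (cell bsd-ssimc).
-/

set_option autoImplicit false
set_option linter.dupNamespace false

noncomputable section

open scoped Classical MatrixGroups ModularForm

open CongruenceSubgroup WeierstrassCurve Literature.NumberTheory.EllipticCurves
  Literature.NumberTheory.EllipticCurves.ModularForms
  Literature.NumberTheory.EllipticCurves.Kobayashi2003 ZpExtension
  Literature.NumberTheory.EllipticCurves.GreenbergVatsal2000
  Literature.NumberTheory.EllipticCurves.BDKim2009
  Literature.NumberTheory.EllipticCurves.Rank1Residual
  Literature.NumberTheory.EllipticCurves.Rank1Residual.Typed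
  Literature.NumberTheory.EllipticCurves.Rank1Residual.X11RankOneCertificates
  Literature.NumberTheory.EllipticCurves.Fisher2012
  Summit.BirchSwinnertonDyer.BirchSwinnertonDyer.Rank1Residual.IntModel
  Summit.BirchSwinnertonDyer.BirchSwinnertonDyer.Rank1Residual.X11RankOne
  Summit.BirchSwinnertonDyer.Rank1Residual.X11b
  Summit.BirchSwinnertonDyer.Rank1Residual.X9
  Summit.BirchSwinnertonDyer.Rank1Residual.X1
  Summit.BirchSwinnertonDyer.Rank1Residual.Supersingular


namespace Summit.BirchSwinnertonDyer.BirchSwinnertonDyer.Theorems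

/-! ### §1 Kernel data: point counts at `3` (`a_3 = 0`), CM of the partners -/

/-- `#{Ẽ(𝔽_3)} = 4` for the Cremona model of `20938a1` = `[1, -1, 0, 2314484, -1714890288]` (`a_3 = 0`: good SUPERSINGULAR at `3`; kernel count). [cite: SilvermanAEC2009, V §2 (a_p = p + 1 − #Ẽ(𝔽_p))] -/
theorem card_cm25_20938a1_3 :
    Nat.card (((⟨1, -1, 0, 2314484, -1714890288⟩ : WeierstrassCurve ℤ).map
      (Int.castRingHom (ZMod 3))).toAffine.Point) = 4 := by
  rw [@WeierstrassCurve.natCard_point_eq_one_add_card (ZMod 3) (@ZMod.instField 3 ⟨by norm_num⟩) _ _ _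
    (by decide +kernel), @card_sol_eq_sum_euler (ZMod 3) (@ZMod.instField 3 ⟨by norm_num⟩) _ _
    (by rw [ZMod.ringChar_zmod_n]; decide), ZMod.card]
  decide +kernel

/-- The CM partner (conductor `361`) = `[0, 0, 1, -38, 90]` has CM (by an order of discriminant `-19`: its `j`-invariant is one of the thirteen rational CM values; kernel check via
`hasCM_iff_j_mem_holds`), for any globally minimal `A` with this integral model. [cite: SilvermanAEC2009, App. C §11] -/
theorem hasCM_cm25A_cmm19_tw1_p3 {A : WeierstrassCurve ℚ} [A.IsElliptic] [A.IsGloballyMinimal]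
    (hIA : integralModelInt A = ⟨0, 0, 1, -38, 90⟩) : A.HasCM :=
  (hasCM_iff_j_mem_holds A).mpr (by rw [j_eq_of_intModel 0 0 1 (-38) 90 hIA]; decide +kernel)

/-- `#{Ẽ(𝔽_3)} = 4` for the Cremona model of `92450t1` = `[1, -1, 1, -124230, 12059317397]` (`a_3 = 0`: good SUPERSINGULAR at `3`; kernel count). [cite: SilvermanAEC2009, V §2 (a_p = p + 1 − #Ẽ(𝔽_p))] -/
theorem card_cm25_92450t1_3 :
    Nat.card (((⟨1, -1, 1, -124230, 12059317397⟩ : WeierstrassCurve ℤ).map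
      (Int.castRingHom (ZMod 3))).toAffine.Point) = 4 := by
  rw [@WeierstrassCurve.natCard_point_eq_one_add_card (ZMod 3) (@ZMod.instField 3 ⟨by norm_num⟩) _ _ _
    (by decide +kernel), @card_sol_eq_sum_euler (ZMod 3) (@ZMod.instField 3 ⟨by norm_num⟩) _ _
    (by rw [ZMod.ringChar_zmod_n]; decide), ZMod.card]
  decide +kernel

/-- `#{Ẽ(𝔽_3)} = 4` for the CM partner `A` of discriminant `-43` (conductor `46225`) = `[0, 0, 1, -21500, 1213406]` (`a_3 = 0`: good SUPERSINGULAR at `3`; kernel count). [cite: SilvermanAEC2009, V §2 (a_p = p + 1 − #Ẽ(𝔽_p))] -/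
theorem card_cm25A_cmm43_tw5_p3 :
    Nat.card (((⟨0, 0, 1, -21500, 1213406⟩ : WeierstrassCurve ℤ).map
      (Int.castRingHom (ZMod 3))).toAffine.Point) = 4 := by
  rw [@WeierstrassCurve.natCard_point_eq_one_add_card (ZMod 3) (@ZMod.instField 3 ⟨by norm_num⟩) _ _ _
    (by decide +kernel), @card_sol_eq_sum_euler (ZMod 3) (@ZMod.instField 3 ⟨by norm_num⟩) _ _
    (by rw [ZMod.ringChar_zmod_n]; decide), ZMod.card]
  decide +kernel

/-- The CM partner (conductor `46225`) = `[0, 0, 1, -21500, 1213406]` has CM (by an order of discriminant `-43`: its `j`-invariant is one of the thirteen rational CM values; kernel check via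
`hasCM_iff_j_mem_holds`), for any globally minimal `A` with this integral model. [cite: SilvermanAEC2009, App. C §11] -/
theorem hasCM_cm25A_cmm43_tw5_p3 {A : WeierstrassCurve ℚ} [A.IsElliptic] [A.IsGloballyMinimal]
    (hIA : integralModelInt A = ⟨0, 0, 1, -21500, 1213406⟩) : A.HasCM :=
  (hasCM_iff_j_mem_holds A).mpr (by rw [j_eq_of_intModel 0 0 1 (-21500) 1213406 hIA]; decide +kernel)

/-- `#{Ẽ(𝔽_3)} = 4` for the Cremona model of `368098c1` = `[1, -1, 0, 1876291178, 60679089630708]` (`a_3 = 0`: good SUPERSINGULAR at `3`; kernel count). [cite: SilvermanAEC2009, V §2 (a_p = p + 1 − #Ẽ(𝔽_p))] -/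
theorem card_cm25_368098c1_3 :
    Nat.card (((⟨1, -1, 0, 1876291178, 60679089630708⟩ : WeierstrassCurve ℤ).map
      (Int.castRingHom (ZMod 3))).toAffine.Point) = 4 := by
  rw [@WeierstrassCurve.natCard_point_eq_one_add_card (ZMod 3) (@ZMod.instField 3 ⟨by norm_num⟩) _ _ _
    (by decide +kernel), @card_sol_eq_sum_euler (ZMod 3) (@ZMod.instField 3 ⟨by norm_num⟩) _ _
    (by rw [ZMod.ringChar_zmod_n]; decide), ZMod.card]
  decide +kernel

/-- The CM partner (conductor `4489`) = `[0, 0, 1, -7370, 243528]` has CM (by an order of discriminant `-67`: its `j`-invariant is one of the thirteen rational CM values; kernel check via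
`hasCM_iff_j_mem_holds`), for any globally minimal `A` with this integral model. [cite: SilvermanAEC2009, App. C §11] -/
theorem hasCM_cm25A_cmm67_tw1_p3 {A : WeierstrassCurve ℚ} [A.IsElliptic] [A.IsGloballyMinimal]
    (hIA : integralModelInt A = ⟨0, 0, 1, -7370, 243528⟩) : A.HasCM :=
  (hasCM_iff_j_mem_holds A).mpr (by rw [j_eq_of_intModel 0 0 1 (-7370) 243528 hIA]; decide +kernel)

/-! ### §2 The records (CM-25 pairs @ 3, rank 0, `BSD(E,3)` a tree theorem) -/

/-- **Kobayashi's ± main conjecture, BOTH signs, for `20938a1 @ 3`** (Cremona model `[1, -1, 0, 2314484, -1714890288]`, `r_an = 0`, `∏_ℓ c_ℓ(E) = 12`,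
`#Ш_an = 9`; X7, `a_3 = 0`, `3Nn`, `K = ℚ(√-19)`) via the CM ELLIPTIC-CURVE PARTNER `A` = `361a1` (CM by `ℤ[(1+√−19)/2]`, `D = −19`) (minimal model
`[0, 0, 1, -38, 90]`, `N = 361`, `3` inert in `K`, `a_3(A) = 0`, `r_an(A) = 1`) — a pair formerly booked «no CM partner» (finding «CM-25»).
KERNEL congruence: `E` ≅ the member `(19 : 1)` of Fisher's DUAL Hesse pencil `X_A⁻(3)` of `A`, `u = 1/228` (`threeCongruent_of_dualHesseCertificate_unconditional`, `norm_num`).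
DISPLAYED: `hμ'` = unit content of `L_3^±(A)` — certificate VALUES (kit j268836, partner key `cmm19_tw1_p3`) engine A (PARI `ellpadiclambdamu` [[λ,λ'],[μ,μ']], N = 361, r_an = 1): `[[1, 5], [0, 0]]`; engine B (b2b msengine, Mazur–Tate layers (μ, λ; λ−q_n)): θ_2 (0, 3; 1), θ_3 (0, 11; 5), θ_4 (0, 21; 1); engine T (iw-2 twisted L-values, V = v_p(Norm S_ψ) = λ(θ_n) when CERTIFIED): θ_1 norm-zero, θ_2 CERTIFIED V = 3, θ_3 CERTIFIED V = 11 ⇒ μ(L_3^±(A)) = 0 read on both surviving engines (μ = 0 at every certified layer; the λ-values are not used by this road); E-side `BSD(E,3)` = the tree's second-descent theorem `bsdp3_b1e_20938a1` (binders `hCT`, `hr`, `hSel9`, `h3c`/`hndiv`, `hs`/`hvs` passed through, displayed). BY NAME (PUBLISHED): `hPR`, `h09`,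
`h12`, `h41`, `hKim`, `h5`, `h3`, `hPollack`, `hmod`, `hmod'`, `hGZK`. Road `kobayashiMainConjecture_of_cmPartner_of_bsdp_of_analyticRank_eq_zero` (module
docstring). NO preprint binder. Per pair; item 4 stays OPEN; nothing booked; BSD is not proved by any of this.
[cite: BDKim2009, Cor. 2.13 (p. 187)] [cite: PollackRubin2004, Theorem (p. 448) = Thm. 7.3] [cite: Kobayashi2003, Thm. 4.1 (p. 8) and Conjecture (p. 2)]
[cite: Fisher2012Hessian, Thm. 13.2 and §13] [cite: Cremona2006, Table 1 (Cremona label 20938a1)] -/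
theorem kobayashiMainConjecture_c20938a1_3_of_mu_of_bsdp_cm25
    (h09 : cor213_signedMu_eq_zero_iff_of_torsionIso)
    (hPR : PollackRubin2004.mainTheorem_signedCharIdeal_eq_of_cm)
    (h12 : Kobayashi2003.thm12_signedSelmerDual_finite_torsion)
    (h41 : Kobayashi2003.thm41_signedCharIdeal_divisibility)
    (hKim : BDKim2013.cor315_signedCharValue_rankZero)
    (h5 : realPeriodRat_eq_unit_mul_plusPeriod) (h3 : realPeriodRat_eq_unit_mul_plusPeriod_three)
    (hPollack : ∀ {V : WeierstrassCurve ℚ} [V.IsElliptic] [V.IsGloballyMinimal] {N : ℕ} [NeZero N]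
      {g : CuspForm (Gamma0 N) 2} {q : ℕ} [Fact q.Prime],
      pollack_exists_plusMinusPAdicLFunction (W := V) (f := g) (p := q))
    (hmod : nonempty_modularParametrizationData) (hmod' : hasEntireLFunction_rat)
    (hGZK : rank_eq_analyticRank_of_analyticRank_le_one)
    (W A : WeierstrassCurve ℚ) [W.IsElliptic] [W.IsGloballyMinimal] [A.IsElliptic] [A.IsGloballyMinimal]
    [Fact (Nat.Prime 3)] (hW : W = ⟨1, -1, 0, 2314484, -1714890288⟩) (hA : A = ⟨0, 0, 1, -38, 90⟩)
    (hμ' : ∀ [NeZero (A.conductorNorm ℤ)] (f' : CuspForm (Gamma0 (A.conductorNorm ℤ)) 2),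
      IsNewformOf A f' → ∀ (Lplus Lminus : IwasawaAlgebra 3), IsPollackPair f' 3 Lplus Lminus →
      ∀ ε : ℤˣ, HasUnitContent (kobayashiL ε Lplus Lminus))
    (hCT : exists_casselsTate_pairing (K := ℚ))
    (hr : W.analyticRank = 0) (hSel9 : Nat.card (W.selmerGroup (3 : ℤ)) = 9)
    {c : W.sha} (h3c : 3 • c = 0) (hndiv : ∀ d : W.sha, 3 • d ≠ c)
    {s : ℚ} (hs : shaAn W = (s : ℂ)) (hvs : padicValRat 3 s = 2) (ε : ℤˣ) :
    KobayashiMainConjecture W 3 ε := by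
  have hIW : integralModelInt W = ⟨1, -1, 0, 2314484, -1714890288⟩ :=
    integralModelInt_eq_of_map_eq _ (by rw [hW]; ext <;> simp [WeierstrassCurve.map])
  have hIA : integralModelInt A = ⟨0, 0, 1, -38, 90⟩ :=
    integralModelInt_eq_of_map_eq _ (by rw [hA]; ext <;> simp [WeierstrassCurve.map])
  have hΔ : (⟨1, -1, 0, 2314484, -1714890288⟩ : WeierstrassCurve ℤ).Δ = discOf [1, -1, 0, 2314484, -1714890288] :=
    intCurve_Δ 1 (-1) 0 2314484 (-1714890288)
  have hΔA : (⟨0, 0, 1, -38, 90⟩ : WeierstrassCurve ℤ).Δ = discOf [0, 0, 1, -38, 90] :=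
    intCurve_Δ 0 0 1 (-38) 90
  have hgood : W.HasGoodReductionAtPrime 3 :=
    hasGoodReductionAtPrime_of_not_dvd W 3 (by rw [minimalDiscriminantInt_eq hIW, hΔ]; decide +kernel)
  have hgoodA : A.HasGoodReductionAtPrime 3 :=
    hasGoodReductionAtPrime_of_not_dvd A 3 (by rw [minimalDiscriminantInt_eq hIA, hΔA]; decide +kernel)
  have hap : W.frobeniusTrace 3 = 0 := by rw [frobeniusTrace_eq hIW card_cm25_20938a1_3]; norm_num
  have hapA : A.frobeniusTrace 3 = 0 := by rw [frobeniusTrace_eq hIA Summit.BirchSwinnertonDyer.Rank1Residual.X12.Records.card_361a1_mod3]; norm_num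
  have hc4 : W.c₄ = (-111095223 : ℚ) := by
    subst hW; norm_num [WeierstrassCurve.c₄, WeierstrassCurve.b₂, WeierstrassCurve.b₄]
  have hc6 : W.c₆ = (1481165280315 : ℚ) := by
    subst hW; norm_num [WeierstrassCurve.c₆, WeierstrassCurve.b₂, WeierstrassCurve.b₄, WeierstrassCurve.b₆]
  have hc4A : A.c₄ = (1824 : ℚ) := by
    subst hA; norm_num [WeierstrassCurve.c₄, WeierstrassCurve.b₂, WeierstrassCurve.b₄]
  have hc6A : A.c₆ = (-77976 : ℚ) := by
    subst hA; norm_num [WeierstrassCurve.c₆, WeierstrassCurve.b₂, WeierstrassCurve.b₄, WeierstrassCurve.b₆]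
  -- the 3-congruence as a THEOREM: `E` is the member (19 : 1) of the DUAL Hesse pencil `X_A⁻(3)` of `A`, scaling `u = 1/228`
  have hiso := threeCongruent_of_dualHesseCertificate_unconditional A W (19 : ℚ) (1 : ℚ) ((1 : ℚ) / 228)
    (by norm_num) (by rw [hc4A, hc6A, hc4, eval_hesseD3]; norm_num)
    (by rw [hc4A, hc6A, hc6, eval_hesseC6three]; norm_num)
  exact kobayashiMainConjecture_of_cmPartner_of_bsdp_of_analyticRank_eq_zero W A 3 h09 hPR h12 h41 hKim h5
    h3 hPollack hmod hmod' hGZK (by norm_num) hgood hap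
    (hasCM_cm25A_cmm19_tw1_p3 hIA) ⟨hgoodA, by rw [hapA]; exact dvd_zero _⟩ hapA hiso hμ' hr
    (Summit.BirchSwinnertonDyer.Rank1Residual.SecondDescent.bsdp3_b1e_20938a1 hGZK hCT W hW hr hSel9 h3c hndiv hs hvs) ε

/-- **Kobayashi's ± main conjecture, BOTH signs, for `92450t1 @ 3`** (Cremona model `[1, -1, 1, -124230, 12059317397]`, `r_an = 0`, `∏_ℓ c_ℓ(E) = 24`,
`#Ш_an = 1`; X7, `a_3 = 0`, `3Nn`, `K = ℚ(√-43)`) via the CM ELLIPTIC-CURVE PARTNER `A` = the twist by `5` of `1849a1` (CM by `ℤ[(1+√−43)/2]`, `D = −43`) (minimal model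
`[0, 0, 1, -21500, 1213406]`, `N = 46225`, `3` inert in `K`, `a_3(A) = 0`, `r_an(A) = 1`) — a pair formerly booked «no CM partner» (finding «CM-25»).
KERNEL congruence: `E` ≅ the member `(3010 : 3)` of Fisher's DUAL Hesse pencil `X_A⁻(3)` of `A`, `u = 1/3870` (`threeCongruent_of_dualHesseCertificate_unconditional`, `norm_num`).
DISPLAYED: `hμ'` = unit content of `L_3^±(A)` — certificate VALUES (kit j268836, partner key `cmm43_tw5_p3`) engine A (PARI `ellpadiclambdamu` [[λ,λ'],[μ,μ']], N = 46225, r_an = 1): `n/a (stack overflow)`; engine B (b2b msengine, Mazur–Tate layers (μ, λ; λ−q_n)): θ_1 (1, 1; 1), θ_2 (0, 3; 1), θ_3 (0, 9; 3), θ_4 (0, 21; 1); engine T (iw-2 twisted L-values, V = v_p(Norm S_ψ) = λ(θ_n) when CERTIFIED): θ_1 undetermi V = 3, θ_2 CERTIFIED V = 3, θ_3 CERTIFIED V = 9 ⇒ μ(L_3^±(A)) = 0 read on both surviving engines (μ = 0 at every certified layer; the λ-values are not used by this road); E-side `BSD(E,3)` = the tree's flag-free `bsdp3_nn92450t1` (`NonsplitCartanThreeDescentRecordsX7Three01.lean`;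 binders `hr`, `hs`/`hvs`, `hSel` passed through, displayed). BY NAME (PUBLISHED): `hPR`, `h09`,
`h12`, `h41`, `hKim`, `h5`, `h3`, `hPollack`, `hmod`, `hmod'`, `hGZK`. Road `kobayashiMainConjecture_of_cmPartner_of_bsdp_of_analyticRank_eq_zero` (module
docstring). NO preprint binder. Per pair; item 4 stays OPEN; nothing booked; BSD is not proved by any of this.
[cite: BDKim2009, Cor. 2.13 (p. 187)] [cite: PollackRubin2004, Theorem (p. 448) = Thm. 7.3] [cite: Kobayashi2003, Thm. 4.1 (p. 8) and Conjecture (p. 2)]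
[cite: Fisher2012Hessian, Thm. 13.2 and §13] [cite: Cremona2006, Table 1 (Cremona label 92450t1)] -/
theorem kobayashiMainConjecture_c92450t1_3_of_mu_of_bsdp_cm25
    (h09 : cor213_signedMu_eq_zero_iff_of_torsionIso)
    (hPR : PollackRubin2004.mainTheorem_signedCharIdeal_eq_of_cm)
    (h12 : Kobayashi2003.thm12_signedSelmerDual_finite_torsion)
    (h41 : Kobayashi2003.thm41_signedCharIdeal_divisibility)
    (hKim : BDKim2013.cor315_signedCharValue_rankZero)
    (h5 : realPeriodRat_eq_unit_mul_plusPeriod) (h3 : realPeriodRat_eq_unit_mul_plusPeriod_three)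
    (hPollack : ∀ {V : WeierstrassCurve ℚ} [V.IsElliptic] [V.IsGloballyMinimal] {N : ℕ} [NeZero N]
      {g : CuspForm (Gamma0 N) 2} {q : ℕ} [Fact q.Prime],
      pollack_exists_plusMinusPAdicLFunction (W := V) (f := g) (p := q))
    (hmod : nonempty_modularParametrizationData) (hmod' : hasEntireLFunction_rat)
    (hGZK : rank_eq_analyticRank_of_analyticRank_le_one)
    (W A : WeierstrassCurve ℚ) [W.IsElliptic] [W.IsGloballyMinimal] [A.IsElliptic] [A.IsGloballyMinimal]
    [Fact (Nat.Prime 3)] (hW : W = ⟨1, -1, 1, -124230, 12059317397⟩) (hA : A = ⟨0, 0, 1, -21500, 1213406⟩)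
    (hμ' : ∀ [NeZero (A.conductorNorm ℤ)] (f' : CuspForm (Gamma0 (A.conductorNorm ℤ)) 2),
      IsNewformOf A f' → ∀ (Lplus Lminus : IwasawaAlgebra 3), IsPollackPair f' 3 Lplus Lminus →
      ∀ ε : ℤˣ, HasUnitContent (kobayashiL ε Lplus Lminus))
    (hr : W.analyticRank = 0) {s : ℚ} (hs : shaAn W = (s : ℂ)) (hvs : padicValRat 3 s = 0)
    (hSel : Nat.card (W.selmerGroup (3 : ℤ)) = 3 ^ W.analyticRank) (ε : ℤˣ) :
    KobayashiMainConjecture W 3 ε := by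
  have hIW : integralModelInt W = ⟨1, -1, 1, -124230, 12059317397⟩ :=
    integralModelInt_eq_of_map_eq _ (by rw [hW]; ext <;> simp [WeierstrassCurve.map])
  have hIA : integralModelInt A = ⟨0, 0, 1, -21500, 1213406⟩ :=
    integralModelInt_eq_of_map_eq _ (by rw [hA]; ext <;> simp [WeierstrassCurve.map])
  have hΔ : (⟨1, -1, 1, -124230, 12059317397⟩ : WeierstrassCurve ℤ).Δ = discOf [1, -1, 1, -124230, 12059317397] :=
    intCurve_Δ 1 (-1) 1 (-124230) 12059317397
  have hΔA : (⟨0, 0, 1, -21500, 1213406⟩ : WeierstrassCurve ℤ).Δ = discOf [0, 0, 1, -21500, 1213406] :=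
    intCurve_Δ 0 0 1 (-21500) 1213406
  have hgood : W.HasGoodReductionAtPrime 3 :=
    hasGoodReductionAtPrime_of_not_dvd W 3 (by rw [minimalDiscriminantInt_eq hIW, hΔ]; decide +kernel)
  have hgoodA : A.HasGoodReductionAtPrime 3 :=
    hasGoodReductionAtPrime_of_not_dvd A 3 (by rw [minimalDiscriminantInt_eq hIA, hΔA]; decide +kernel)
  have hap : W.frobeniusTrace 3 = 0 := by rw [frobeniusTrace_eq hIW card_cm25_92450t1_3]; norm_num
  have hapA : A.frobeniusTrace 3 = 0 := by rw [frobeniusTrace_eq hIA card_cm25A_cmm43_tw5_p3]; norm_num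
  have hc4 : W.c₄ = (5963025 : ℚ) := by
    subst hW; norm_num [WeierstrassCurve.c₄, WeierstrassCurve.b₂, WeierstrassCurve.b₄]
  have hc6 : W.c₆ = (-10419223397625 : ℚ) := by
    subst hW; norm_num [WeierstrassCurve.c₆, WeierstrassCurve.b₂, WeierstrassCurve.b₄, WeierstrassCurve.b₆]
  have hc4A : A.c₄ = (1032000 : ℚ) := by
    subst hA; norm_num [WeierstrassCurve.c₄, WeierstrassCurve.b₂, WeierstrassCurve.b₄]
  have hc6A : A.c₆ = (-1048383000 : ℚ) := by
    subst hA; norm_num [WeierstrassCurve.c₆, WeierstrassCurve.b₂, WeierstrassCurve.b₄, WeierstrassCurve.b₆]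
  -- the 3-congruence as a THEOREM: `E` is the member (3010 : 3) of the DUAL Hesse pencil `X_A⁻(3)` of `A`, scaling `u = 1/3870`
  have hiso := threeCongruent_of_dualHesseCertificate_unconditional A W ((3010 : ℚ) / 3) (1 : ℚ) ((1 : ℚ) / 3870)
    (by norm_num) (by rw [hc4A, hc6A, hc4, eval_hesseD3]; norm_num)
    (by rw [hc4A, hc6A, hc6, eval_hesseC6three]; norm_num)
  exact kobayashiMainConjecture_of_cmPartner_of_bsdp_of_analyticRank_eq_zero W A 3 h09 hPR h12 h41 hKim h5
    h3 hPollack hmod hmod' hGZK (by norm_num) hgood hap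
    (hasCM_cm25A_cmm43_tw5_p3 hIA) ⟨hgoodA, by rw [hapA]; exact dvd_zero _⟩ hapA hiso hμ' hr
    (bsdp3_nn92450t1 hGZK W hW (hr.trans_le zero_le_one) hs hvs hSel) ε

/-- **Kobayashi's ± main conjecture, BOTH signs, for `368098c1 @ 3`** (Cremona model `[1, -1, 0, 1876291178, 60679089630708]`, `r_an = 0`, `∏_ℓ c_ℓ(E) = 12`,
`#Ш_an = 4`; X7, `a_3 = 0`, `3Nn`, `K = ℚ(√-67)`) via the CM ELLIPTIC-CURVE PARTNER `A` = `4489a1` (CM by `ℤ[(1+√−67)/2]`, `D = −67`) (minimal model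
`[0, 0, 1, -7370, 243528]`, `N = 4489`, `3` inert in `K`, `a_3(A) = 0`, `r_an(A) = 1`) — a pair formerly booked «no CM partner» (finding «CM-25»).
KERNEL congruence: `E` ≅ the member `(7705 : 13)` of Fisher's DUAL Hesse pencil `X_A⁻(3)` of `A`, `u = 1/10452` (`threeCongruent_of_dualHesseCertificate_unconditional`, `norm_num`).
DISPLAYED: `hμ'` = unit content of `L_3^±(A)` — certificate VALUES (kit j268836, partner key `cmm67_tw1_p3`) engine A (PARI `ellpadiclambdamu` [[λ,λ'],[μ,μ']], N = 4489, r_an = 1): `[[1, 1], [0, 0]]`; engine B (b2b msengine, Mazur–Tate layers (μ, λ; λ−q_n)): θ_1 (0, 1; 1), θ_2 (0, 3; 1), θ_3 (0, 7; 1), θ_4 (0, 21; 1); engine T (iw-2 twisted L-values, V = v_p(Norm S_ψ) = λ(θ_n) when CERTIFIED): θ_1 CERTIFIED V = 1, θ_2 CERTIFIED V = 3, θ_3 CERTIFIED V = 7 ⇒ μ(L_3^±(A)) = 0 read on both surviving engines (μ = 0 at every certified layer; the λ-values are not used by this road); E-side `BSD(E,3)` = the tree's flag-free `bsdp3_nn368098c1`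 (`NonsplitCartanThreeDescentRecordsX7Three05.lean`; binders `hr`, `hs`/`hvs`, `hSel` passed through, displayed). BY NAME (PUBLISHED): `hPR`, `h09`,
`h12`, `h41`, `hKim`, `h5`, `h3`, `hPollack`, `hmod`, `hmod'`, `hGZK`. Road `kobayashiMainConjecture_of_cmPartner_of_bsdp_of_analyticRank_eq_zero` (module
docstring). NO preprint binder. Per pair; item 4 stays OPEN; nothing booked; BSD is not proved by any of this.
[cite: BDKim2009, Cor. 2.13 (p. 187)] [cite: PollackRubin2004, Theorem (p. 448) = Thm. 7.3] [cite: Kobayashi2003, Thm. 4.1 (p. 8) and Conjecture (p. 2)]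
[cite: Fisher2012Hessian, Thm. 13.2 and §13] [cite: Cremona2006, Table 1 (Cremona label 368098c1)] -/
theorem kobayashiMainConjecture_c368098c1_3_of_mu_of_bsdp_cm25
    (h09 : cor213_signedMu_eq_zero_iff_of_torsionIso)
    (hPR : PollackRubin2004.mainTheorem_signedCharIdeal_eq_of_cm)
    (h12 : Kobayashi2003.thm12_signedSelmerDual_finite_torsion)
    (h41 : Kobayashi2003.thm41_signedCharIdeal_divisibility)
    (hKim : BDKim2013.cor315_signedCharValue_rankZero)
    (h5 : realPeriodRat_eq_unit_mul_plusPeriod) (h3 : realPeriodRat_eq_unit_mul_plusPeriod_three)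
    (hPollack : ∀ {V : WeierstrassCurve ℚ} [V.IsElliptic] [V.IsGloballyMinimal] {N : ℕ} [NeZero N]
      {g : CuspForm (Gamma0 N) 2} {q : ℕ} [Fact q.Prime],
      pollack_exists_plusMinusPAdicLFunction (W := V) (f := g) (p := q))
    (hmod : nonempty_modularParametrizationData) (hmod' : hasEntireLFunction_rat)
    (hGZK : rank_eq_analyticRank_of_analyticRank_le_one)
    (W A : WeierstrassCurve ℚ) [W.IsElliptic] [W.IsGloballyMinimal] [A.IsElliptic] [A.IsGloballyMinimal]
    [Fact (Nat.Prime 3)] (hW : W = ⟨1, -1, 0, 1876291178, 60679089630708⟩) (hA : A = ⟨0, 0, 1, -7370, 243528⟩)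
    (hμ' : ∀ [NeZero (A.conductorNorm ℤ)] (f' : CuspForm (Gamma0 (A.conductorNorm ℤ)) 2),
      IsNewformOf A f' → ∀ (Lplus Lminus : IwasawaAlgebra 3), IsPollackPair f' 3 Lplus Lminus →
      ∀ ε : ℤˣ, HasUnitContent (kobayashiL ε Lplus Lminus))
    (hr : W.analyticRank = 0) {s : ℚ} (hs : shaAn W = (s : ℂ)) (hvs : padicValRat 3 s = 0)
    (hSel : Nat.card (W.selmerGroup (3 : ℤ)) = 3 ^ W.analyticRank) (ε : ℤˣ) :
    KobayashiMainConjecture W 3 ε := by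
  have hIW : integralModelInt W = ⟨1, -1, 0, 1876291178, 60679089630708⟩ :=
    integralModelInt_eq_of_map_eq _ (by rw [hW]; ext <;> simp [WeierstrassCurve.map])
  have hIA : integralModelInt A = ⟨0, 0, 1, -7370, 243528⟩ :=
    integralModelInt_eq_of_map_eq _ (by rw [hA]; ext <;> simp [WeierstrassCurve.map])
  have hΔ : (⟨1, -1, 0, 1876291178, 60679089630708⟩ : WeierstrassCurve ℤ).Δ = discOf [1, -1, 0, 1876291178, 60679089630708] :=
    intCurve_Δ 1 (-1) 0 1876291178 60679089630708
  have hΔA : (⟨0, 0, 1, -7370, 243528⟩ : WeierstrassCurve ℤ).Δ = discOf [0, 0, 1, -7370, 243528] :=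
    intCurve_Δ 0 0 1 (-7370) 243528
  have hgood : W.HasGoodReductionAtPrime 3 :=
    hasGoodReductionAtPrime_of_not_dvd W 3 (by rw [minimalDiscriminantInt_eq hIW, hΔ]; decide +kernel)
  have hgoodA : A.HasGoodReductionAtPrime 3 :=
    hasGoodReductionAtPrime_of_not_dvd A 3 (by rw [minimalDiscriminantInt_eq hIA, hΔA]; decide +kernel)
  have hap : W.frobeniusTrace 3 = 0 := by rw [frobeniusTrace_eq hIW card_cm25_368098c1_3]; norm_num
  have hapA : A.frobeniusTrace 3 = 0 := by rw [frobeniusTrace_eq hIA Summit.BirchSwinnertonDyer.Rank1Residual.X12.Records.card_4489a1_mod3]; norm_num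
  have hc4 : W.c₄ = (-90061976535 : ℚ) := by
    subst hW; norm_num [WeierstrassCurve.c₄, WeierstrassCurve.b₂, WeierstrassCurve.b₄]
  have hc6 : W.c₆ = (-52427138719826133 : ℚ) := by
    subst hW; norm_num [WeierstrassCurve.c₆, WeierstrassCurve.b₂, WeierstrassCurve.b₄, WeierstrassCurve.b₆]
  have hc4A : A.c₄ = (353760 : ℚ) := by
    subst hA; norm_num [WeierstrassCurve.c₄, WeierstrassCurve.b₂, WeierstrassCurve.b₄]
  have hc6A : A.c₆ = (-210408408 : ℚ) := by
    subst hA; norm_num [WeierstrassCurve.c₆, WeierstrassCurve.b₂, WeierstrassCurve.b₄, WeierstrassCurve.b₆]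
  -- the 3-congruence as a THEOREM: `E` is the member (7705 : 13) of the DUAL Hesse pencil `X_A⁻(3)` of `A`, scaling `u = 1/10452`
  have hiso := threeCongruent_of_dualHesseCertificate_unconditional A W ((7705 : ℚ) / 13) (1 : ℚ) ((1 : ℚ) / 10452)
    (by norm_num) (by rw [hc4A, hc6A, hc4, eval_hesseD3]; norm_num)
    (by rw [hc4A, hc6A, hc6, eval_hesseC6three]; norm_num)
  exact kobayashiMainConjecture_of_cmPartner_of_bsdp_of_analyticRank_eq_zero W A 3 h09 hPR h12 h41 hKim h5
    h3 hPollack hmod hmod' hGZK (by norm_num) hgood hap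
    (hasCM_cm25A_cmm67_tw1_p3 hIA) ⟨hgoodA, by rw [hapA]; exact dvd_zero _⟩ hapA hiso hμ' hr
    (bsdp3_nn368098c1 hGZK W hW (hr.trans_le zero_le_one) hs hvs hSel) ε

end Summit.BirchSwinnertonDyer.BirchSwinnertonDyer.Theorems

end
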